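import Summits.BirchSwinnertonDyer.Rank1Residual.X12.O11.RamifiedStrictDescentAtThreeLocal
import Summits.BirchSwinnertonDyer.Rank1Residual.X11b.BDPRouteControlStrictPlace
import Summits.BirchSwinnertonDyer.Rank1Residual.X11b.BDPRouteNonsingularTorsionDivisible
import Summits.BirchSwinnertonDyer.Rank1Residual.X11b.AnticyclotomicLocalKernelTrivial
import HarnessLib

/-!
# O11 at `p = 3`, companion IV — regime V of route `PrintCFram` (item stmt-BirchSwinnertonDyer-20700):
# the TAMAGAWA-AWARE one-sided control at a `3`-frame, PROVED — with (A𝔭)₃ only, and the degree-one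
# away input (Av)₃ demanded OFF a finite set `T₀` of places `v ∤ 3`,
# `#Sel_𝔭(K^ac_∞, W[3^∞])^Γ ≤ #Sel_str(W/ℚ)[3^∞] · #Sel_str(W'/ℚ)[3^∞] · 3^{Σ_{v ∈ T₀} ord₃ c_v(W_K)}`
# (cell `bsd-print-cfram`, D-0131 (2), typer `ty2` gen 2; PLAN v2 §2 ty2 (γ))

HONEST FRAMING (cell `bsd-print-cfram`, HOME `run/shared/lean/pub/bsd-print-cfram/`): THEOREMS ONLY
(no definition, no named fact, no axiom, no `sorry`); nothing about BSD is booked; regime V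
(`Theses.PrintCFram.SplitPlaceTorsionBSDThree`) and the leaf stay OPEN; beyond-print theorem: NO.

WHY. On regime V of the C1 split ((A𝔭)₃ holds, (Av)₃ FAILS at some degree-one bad place `v ∤ 3` of
`K = ℚ(√−3)` with a `K_v`-rational `3`-torsion point, i.e. `3 ∣ c_v(W_K)`) gen 1's EXACT control
(`controlMap_bijective_of_isFrameThree`, hence (R-ctrl)₃ `ramifiedCMStrictControlAtThree_holds`) is not
available: such `v` is finitely decomposed in the anticyclotomic `ℤ₃`-tower and Greenberg's local
kernel `ker r_v` has order dividing `c_v^{(3)}` (LNM 1716 Lemma 3.3) instead of vanishing. The planner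
asked (PLAN v2 §2 ty2 (γ)) for a Tamagawa-aware control statement for the V line. What the tree PROVES
— and this file assembles at a `3`-frame — is the ONE-SIDED form, with NO hypothesis at the offending
places:

* §1 `awayCondition_descends_three_at` — gen 1's away descent (`awayConditions_descend_three`) made
  POINTWISE: at a single `v ∤ 3`, given (Av)₃ AT `v` only when `v` has degree one (inert / ramified
  places split completely in `K^ac_∞` and need nothing).
* §2 `natCard_invariants_le_mul_tamagawa_of_isFrameThree` — at a `3`-frame with `W(K_𝔭)[3] = 0`, for
  every finite set `T₀` of places `v ∤ 3` such that (Av)₃ holds at every degree-one `v ∉ T₀`: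
  `Sel^γ := H⁰(⟨γ⟩, Sel_𝔭(K_∞, W[3^∞]))` is finite when `Sel_𝔭(K, W[3^∞])` is, and
  `#Sel^γ ≤ #Sel_𝔭(K, W[3^∞]) · 3^{Σ_{v ∈ T₀} ord₃ c_v(W_K)}` — X11b's counting snake lemma with the
  strict place counted (`AcSelmer.finite_endInvariants_and_natCard_le_of_localKer_strict`, cell
  b2b-bsdres) fed with `ker r_𝔭 = 0` (`AcSelmer.localKer_eq_bot_of_noPTorsion`) and Greenberg's
  Lemma 3.3 `#ker r_v ≤ c_v^{(3)}` (`AcSelmer.natCard_localKer_le_pow_padicValNat_localTamagawaNumber`).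
* §3 `natCard_invariants_le_strictSelmer_mul_tamagawa_of_isFrameThree` — the same with (A𝔭)₃ read from
  the two `ℚ₃`-binders of the route items (`noThreeTorsion_adicCompletion_of_isFrameThree`) and the
  unconditional twist count (D♮)₃ (`natCard_selmerAcBase_frameThree_eq_mul`):
  `#Sel^γ ≤ #Sel_str(W)[3^∞] · #Sel_str(W')[3^∞] · 3^{Σ_{v ∈ T₀} ord₃ c_v(W_K)}`; with `T₀ = ∅` this is
  the `≤` half of gen 1's equality on regime N (`natCard_invariants_le_strictSelmer_of_regimeN`).

WHAT IS NOT HERE, AND WHY (report to the planner, PLAN v2 §2 ty2 (γ) «hypothesis: Poitou–Tate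
surjectivity»): the reverse inequality / an EXACT identity `#Sel^γ = #Sel_𝔭(K) · ∏_{v ∈ T₀} #ker r_v`
would need the localisation map `H¹(K_Σ/K, W[3^∞]) → ⊕_{v ∈ T₀ ∪ {𝔭}} (local conditions)` to be
SURJECTIVE onto `⊕ ker r_v`; by Poitou–Tate its cokernel is dual to the compact Selmer group of the
DUAL local conditions, which for the STRICT condition at `𝔭` is the `𝔭`-RELAXED compact Selmer group
`S_rel(K, T₃W) ⊇ E(K) ⊗ ℤ₃`, of `ℤ₃`-rank `rank W(ℚ) + rank W'(ℚ) = 2` at an analytic-rank-one frame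
(GZK) — so that surjectivity FAILS here and the true defect on regime V is
`#((⊕_{v ∈ T₀} ker r_v) ∩ im loc)`, a quantity `≤ ∏ c_v^{(3)}` that depends on the local divisibility
of the Mordell–Weil generators at the places of `T₀`, not on the Tamagawa numbers alone. No typed
`(R-ctrl)₃♯` equality is therefore offered (it would be false as an identity with `∏ c_v^{(3)}` and
not statable from print with the intersection term); the V line needs either that intersection made
explicit or a `T₀`-IMPRIMITIVE Selmer structure (relax the conditions at `T₀`, where control is again
exact and the `c_v` move into the Euler-characteristic / `p`-adic `L`-side — Greenberg–Vatsal style).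
Nothing of this paragraph is asserted in Lean.

References: [GreenbergLNM1716] §3 Lemmas 3.1–3.3 (pp. 85–87), p. 90, §4 (Thm. 4.1: the Tamagawa
factors in the control formula); [JetchevSkinnerWan2017] §3.3, Prop. 3.3.4 (`#ker r_w = c_w^{(p)}`;
shape only); [Castella2018] Def. 2.2, Thm. 2.3 (arXiv:1704.06608 p. 5); tree: X11b
`BDPRouteControlStrictPlace.lean`, `BDPRouteNonsingularTorsionDivisible.lean`,
`AnticyclotomicLocalKernelTrivial.lean` (cell b2b-bsdres), gen 1 `RamifiedStrictDescentAtThreeLocal.lean`;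
route file `Theses/PrintCFram.lean` rev 11 (item 20700 docstring); HOME/DOSSIER.md §26 (Greenberg §3).
-/

noncomputable section

open scoped Classical

open WeierstrassCurve NumberField IsDedekindDomain Field
  Literature.NumberTheory.EllipticCurves
  Literature.NumberTheory.EllipticCurves.GreenbergSelmer
  Literature.NumberTheory.EllipticCurves.Rank1Residual
  Literature.NumberTheory.GaloisRepresentations
  Summit.BirchSwinnertonDyer.Rank1Residual
  Summit.BirchSwinnertonDyer.Rank1Residual.Additive
  Summit.BirchSwinnertonDyer.Rank1Residual.X11b
  Summit.BirchSwinnertonDyer.Rank1Residual.X11b.AcSelmer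
  Summit.BirchSwinnertonDyer.BirchSwinnertonDyer.Theorems

namespace Summit.BirchSwinnertonDyer.Rank1Residual.X12.O11

/-! ## §1 Away descent at `3`, POINTWISE in the place -/

section Pointwise

variable (W : WeierstrassCurve ℚ) [W.IsElliptic] {K : Type} [Field K] [NumberField K]

/-- **The away condition descends at a single finite `v ∤ 3` in the anticyclotomic `ℤ₃`-tower of a
quadratic field, given (Av)₃ AT `v` when `v` has degree one.** `K` with `[K : ℚ] = 2`, `κ`
anticyclotomic, `𝔭` any finite place, `Σ = ∅`; if `c ∈ H¹(K, W[3^∞])` restricts into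
`Sel_𝔭(K_∞, W[3^∞])` then `c` is locally trivial at `v`, provided that — only in case `v` has
`e = f = 1` over `ℚ` — `W_K` is good at `v` or `W(K_v)[3] = 0`. Places of residue degree `2` or
ramification index `2` split completely in the anticyclotomic tower and need no hypothesis. Gen 1's
`awayConditions_descend_three`, pointwise. [cite: GreenbergLNM1716, §3 Lemma 3.3 and p. 87 (primes splitting completely)]
[cite: Washington1997, Prop. 13.2 and §13.1] -/
theorem awayCondition_descends_three_at (hK : Module.finrank ℚ K = 2)
    {κ : ZpExtension K 3} (hκ : κ.IsAnticyclotomic) (𝔭 : HeightOneSpectrum (𝓞 K))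
    (c : (W.baseChange K).subgroupH1 3 (⊤ : Subgroup (absoluteGaloisGroup K)))
    (hc : (W.baseChange K).resOfLe 3 (le_top : κ.kerSubgroup ≤ ⊤) c ∈
      selmerAc (W.baseChange K) 3 κ 𝔭 ∅)
    (v : HeightOneSpectrum (𝓞 K)) (hpv : ((3 : ℕ) : 𝓞 K) ∉ v.asIdeal)
    (hv : v.asIdeal.ramificationIdx (𝓞 ℚ) = 1 → v.asIdeal.inertiaDeg (𝓞 ℚ) = 1 →
      (W.baseChange K).HasGoodReductionAt v ∨
        ∀ R : ((W.baseChange K).baseChange (v.adicCompletion K)).toAffine.Point,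
          (3 : ℕ) • R = 0 → R = 0) :
    c ∈ awayKer ⊤ ((W.baseChange K).geomPrimaryTorsion 3) v := by
  haveI : (W.baseChange K).IsElliptic := by rw [baseChange]; infer_instance
  have hvS : v ∉ (∅ : Set (HeightOneSpectrum (𝓞 K))) := Set.notMem_empty v
  -- the away condition at the place of `K_∞` above `v`
  have h1 := ((mem_selmerOver_iff _).mp hc).1 v hpv hvS 1
  rw [Literature.NumberTheory.EllipticCurves.conjH1_one_holds, AddMonoidHom.id_apply] at h1
  set v₀ : HeightOneSpectrum (𝓞 ℚ) := v.under (𝓞 ℚ) with hv₀def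
  rcases placesOver_trichotomy_of_finrank_eq_two K hK v₀ with
      ⟨w₁, w₂, -, -, hef⟩ | ⟨w, hset, -, hf⟩ | ⟨w, hset, he, -⟩
  · -- degree one: the displayed input (Av)₃ at `v`
    obtain ⟨he, hf⟩ := hef v rfl
    rcases hv he hf with hgood | htors
    · exact (resOfLe_mem_awayKer_kerSubgroup_iff_of_hasGoodReductionAt (W.baseChange K) 3 κ hpv
        hgood c).mp h1
    · exact mem_awayKer_of_localKer_eq_bot hpv hvS
        (AcSelmer.localKer_eq_bot_of_noPTorsion (W.baseChange K) 3 κ v htors) hc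
  · -- residue degree two: `v` splits completely in the anticyclotomic tower
    have hvw : v = w := by
      have hmem : v ∈ {w' : HeightOneSpectrum (𝓞 K) | w'.under (𝓞 ℚ) = v₀} := rfl
      rw [hset] at hmem
      exact hmem
    have hf' : v.asIdeal.inertiaDeg (𝓞 ℚ) = 2 := by rw [hvw]; exact hf
    exact (IsAnticyclotomic.resOfLe_mem_awayKer_iff_of_inertiaDeg_eq_two hK hκ hpv
      (ℓ := v₀) rfl hf' c).mp h1
  · -- ramification index two: `v` splits completely as well
    have hvw : v = w := by
      have hmem : v ∈ {w' : HeightOneSpectrum (𝓞 K) | w'.under (𝓞 ℚ) = v₀} := rfl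
      rw [hset] at hmem
      exact hmem
    have he' : v.asIdeal.ramificationIdx (𝓞 ℚ) = 2 := by rw [hvw]; exact he
    exact (IsAnticyclotomic.resOfLe_mem_awayKer_iff_of_ramificationIdx_eq_two hK hκ hpv he' c).mp
      h1

end Pointwise

/-! ## §2 One-sided control at a `3`-frame with the Tamagawa defect on a finite set `T₀` -/

section Control

variable {W : WeierstrassCurve ℚ} [W.IsElliptic] {K : Type} [Field K] [NumberField K]
  {𝔭 : HeightOneSpectrum (𝓞 K)} {W' : WeierstrassCurve ℚ} {C : VariableChange ℚ}

/-- **TAMAGAWA-AWARE ONE-SIDED CONTROL at a `3`-frame (regimes N ∪ V).** At a `3`-frame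
`(K, 𝔭, W', C)` of `W` (`K = ℚ(√−3)`), for every anticyclotomic `ℤ₃`-extension `κ` with topological
generator `γ`, granted `W(K_𝔭)[3] = 0` ((A𝔭)₃) and a finite set `T₀` of finite places `v ∤ 3` of `K`
such that (Av)₃ («good reduction or no non-zero `K_v`-rational `3`-torsion») holds at every
DEGREE-ONE `v ∤ 3` OUTSIDE `T₀`: if `Sel_𝔭(K, W[3^∞])` (`Σ = ∅`) is finite then so is
`Sel^γ = H⁰(⟨γ⟩, Sel_𝔭(K_∞, W[3^∞]))`, and
`#Sel^γ ≤ #Sel_𝔭(K, W[3^∞]) · 3^{Σ_{v ∈ T₀} ord₃ c_v(W_K)}`, `c_v(W_K)` the local Tamagawa number of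
`W_K` at `v`. PROOF: X11b's counting snake lemma with `T = {𝔭} ∪ T₀`: away descent off `T` (§1),
`ker r_𝔭 = 0` from (A𝔭)₃, and Greenberg's Lemma 3.3 `#ker r_v ≤ c_v^{(3)}` on `T₀`. NO hypothesis at
the places of `T₀`; nothing asserted beyond the inequality.
[cite: GreenbergLNM1716, §3 Lemmas 3.1–3.3 (pp. 85–87) and p. 90]
[cite: JetchevSkinnerWan2017, §3.3 and Prop. 3.3.4 (shape only)]
[cite: Castella2018, Def. 2.2 and Thm. 2.3 (arXiv:1704.06608 p. 5) (shape only)] -/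
theorem natCard_invariants_le_mul_tamagawa_of_isFrameThree (hF : IsFrameThree W K 𝔭 W' C)
    (κ : ZpExtension K 3) (hκ : κ.IsAnticyclotomic) (γ : absoluteGaloisGroup K)
    [hγ : Fact (κ.IsTopGenerator γ)]
    (h𝔭 : ∀ R : ((W.baseChange K).baseChange (𝔭.adicCompletion K)).toAffine.Point,
      (3 : ℕ) • R = 0 → R = 0)
    (T₀ : Finset (HeightOneSpectrum (𝓞 K))) (hT₀ : ∀ v ∈ T₀, ((3 : ℕ) : 𝓞 K) ∉ v.asIdeal)
    (hv : ∀ v : HeightOneSpectrum (𝓞 K), v ∉ T₀ → ((3 : ℕ) : 𝓞 K) ∉ v.asIdeal →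
      v.asIdeal.ramificationIdx (𝓞 ℚ) = 1 → v.asIdeal.inertiaDeg (𝓞 ℚ) = 1 →
      (W.baseChange K).HasGoodReductionAt v ∨
        ∀ R : ((W.baseChange K).baseChange (v.adicCompletion K)).toAffine.Point,
          (3 : ℕ) • R = 0 → R = 0)
    [Finite (selmerAcBase (W.baseChange K) 3 𝔭 ∅)] :
    Finite (IwasawaDual.endInvariants
        (Castella2018.AcSelmer.conjSelmerAc (W.baseChange K) 3 κ 𝔭 ∅ γ - 1)) ∧
      Nat.card (IwasawaDual.endInvariants
          (Castella2018.AcSelmer.conjSelmerAc (W.baseChange K) 3 κ 𝔭 ∅ γ - 1)) ≤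
        Nat.card (selmerAcBase (W.baseChange K) 3 𝔭 ∅) *
          3 ^ (∑ v ∈ T₀, padicValNat 3
            (((W.baseChange K).baseChange (v.adicCompletion K)).localTamagawaNumber
              (v.adicCompletionIntegers K))) := by
  haveI : IsTotallyComplex K := hF.2.2.1.2
  haveI hEK : (W.baseChange K).IsElliptic := by rw [baseChange]; infer_instance
  have hK2 : Module.finrank ℚ K = 2 := hF.2.2.1.1
  have h3𝔭 : ((3 : ℕ) : 𝓞 K) ∈ 𝔭.asIdeal := hF.2.2.2.2.1
  have h𝔭T₀ : 𝔭 ∉ T₀ := fun h => hT₀ 𝔭 h h3𝔭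
  -- the local kernel at `𝔭` vanishes under (A𝔭)₃
  have hbot : localKer κ.kerSubgroup ((W.baseChange K).geomPrimaryTorsion 3) 𝔭 = ⊥ :=
    AcSelmer.localKer_eq_bot_of_noPTorsion (W.baseChange K) 3 κ 𝔭 h𝔭
  -- the counting snake lemma with `T = {𝔭} ∪ T₀`
  obtain ⟨hfin, hle⟩ := finite_endInvariants_and_natCard_le_of_localKer_strict
    (W := W.baseChange K) (S := (∅ : Set (HeightOneSpectrum (𝓞 K)))) hγ.out (insert 𝔭 T₀)
    (Finset.mem_insert_self 𝔭 T₀)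
    (fun v hvT hne => hT₀ v ((Finset.mem_insert.mp hvT).resolve_left hne))
    (fun v _ => Set.notMem_empty v)
    (fun c hc v hpv _ hvT =>
      awayCondition_descends_three_at W hK2 hκ 𝔭 c hc v hpv
        (hv v (fun h => hvT (Finset.mem_insert_of_mem h)) hpv))
    (fun v hvT => by
      rcases Finset.mem_insert.mp hvT with rfl | hvT₀
      · rw [hbot]; infer_instance
      · exact (natCard_localKer_le_pow_padicValNat_localTamagawaNumber (W.baseChange K) κ
          (hT₀ v hvT₀)).1)
  refine ⟨hfin, hle.trans ?_⟩
  rw [Finset.prod_insert h𝔭T₀, hbot, AddSubgroup.card_bot, one_mul, ← Finset.prod_pow_eq_pow_sum]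
  exact Nat.mul_le_mul le_rfl (Finset.prod_le_prod' fun v hvT₀ =>
    (natCard_localKer_le_pow_padicValNat_localTamagawaNumber (W.baseChange K) κ (hT₀ v hvT₀)).2)

/-! ## §3 With (A𝔭)₃ from the two `ℚ₃`-binders and the twist count (D♮)₃ -/

/-- **`#Sel^γ ≤ #Sel_str(W/ℚ)[3^∞] · #Sel_str(W'/ℚ)[3^∞] · 3^{Σ_{v ∈ T₀} ord₃ c_v(W_K)}`** at a
`3`-frame of `W` with globally minimal twin `W'`, anticyclotomic `κ` with generator `γ`: the no-`3`-
torsion binders over `ℚ₃` for `W` and `W'` give (A𝔭)₃ over `K_𝔭 = ℚ₃(√−3)`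
(`noThreeTorsion_adicCompletion_of_isFrameThree`), §2 gives the one-sided control with the Tamagawa
defect on `T₀` (the degree-one away input being demanded only off `T₀`), and the unconditional twist
count (D♮)₃ (`natCard_selmerAcBase_frameThree_eq_mul`) rewrites `#Sel_𝔭(K, W[3^∞])`. Finiteness of
`Sel_𝔭(K, W[3^∞])` is the displayed hypothesis (under GZK at an analytic-rank-one frame it holds:
gen 1's proof of `ramifiedCMStrictTorsionAtThree_of_GZK`). On regime V take `T₀ ⊇` the degree-one bad
places with `3 ∣ c_v`; the places of `T₀` need NO hypothesis.
[cite: GreenbergLNM1716, §3 Lemma 3.3 (p. 87), p. 90 and §4 Thm. 4.1 (shape of the Tamagawa factors)]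
[cite: DokchitserDokchitserAnnals2010, Lemma 4.14 (proof) (the twist decomposition)] -/
theorem natCard_invariants_le_strictSelmer_mul_tamagawa_of_isFrameThree [W'.IsElliptic]
    (hF : IsFrameThree W K 𝔭 W' C)
    (κ : ZpExtension K 3) (hκ : κ.IsAnticyclotomic) (γ : absoluteGaloisGroup K)
    [Fact (κ.IsTopGenerator γ)]
    (htors : ∀ Q : (W.baseChange ℚ_[3]).toAffine.Point, (3 : ℕ) • Q = 0 → Q = 0)
    (htors' : ∀ Q : (W'.baseChange ℚ_[3]).toAffine.Point, (3 : ℕ) • Q = 0 → Q = 0)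
    (T₀ : Finset (HeightOneSpectrum (𝓞 K))) (hT₀ : ∀ v ∈ T₀, ((3 : ℕ) : 𝓞 K) ∉ v.asIdeal)
    (hv : ∀ v : HeightOneSpectrum (𝓞 K), v ∉ T₀ → ((3 : ℕ) : 𝓞 K) ∉ v.asIdeal →
      v.asIdeal.ramificationIdx (𝓞 ℚ) = 1 → v.asIdeal.inertiaDeg (𝓞 ℚ) = 1 →
      (W.baseChange K).HasGoodReductionAt v ∨
        ∀ R : ((W.baseChange K).baseChange (v.adicCompletion K)).toAffine.Point,
          (3 : ℕ) • R = 0 → R = 0)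
    [Finite (selmerAcBase (W.baseChange K) 3 𝔭 ∅)] :
    Finite (IwasawaDual.endInvariants
        (Castella2018.AcSelmer.conjSelmerAc (W.baseChange K) 3 κ 𝔭 ∅ γ - 1)) ∧
      Nat.card (IwasawaDual.endInvariants
          (Castella2018.AcSelmer.conjSelmerAc (W.baseChange K) 3 κ 𝔭 ∅ γ - 1)) ≤
        Nat.card ↥(strictSelmerPInfty W 3) * Nat.card ↥(strictSelmerPInfty W' 3) *
          3 ^ (∑ v ∈ T₀, padicValNat 3
            (((W.baseChange K).baseChange (v.adicCompletion K)).localTamagawaNumber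
              (v.adicCompletionIntegers K))) := by
  rw [← natCard_selmerAcBase_frameThree_eq_mul W hF]
  exact natCard_invariants_le_mul_tamagawa_of_isFrameThree hF κ hκ γ
    (noThreeTorsion_adicCompletion_of_isFrameThree W hF htors htors') T₀ hT₀ hv

/-- **Regime N as the case `T₀ = ∅`**: with (Av)₃ at EVERY degree-one `v ∤ 3` the defect term is
`3^0 = 1` and `#Sel^γ ≤ #Sel_str(W)[3^∞] · #Sel_str(W')[3^∞]` — the `≤` half of gen 1's equality
(`strictControl_frameThree_natCard_eq` + (D♮)₃), recovered from the Tamagawa-aware statement.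
[cite: GreenbergLNM1716, §3 Thm. 1.2 and p. 90] -/
theorem natCard_invariants_le_strictSelmer_of_regimeN [W'.IsElliptic] (hF : IsFrameThree W K 𝔭 W' C)
    (κ : ZpExtension K 3) (hκ : κ.IsAnticyclotomic) (γ : absoluteGaloisGroup K)
    [Fact (κ.IsTopGenerator γ)]
    (htors : ∀ Q : (W.baseChange ℚ_[3]).toAffine.Point, (3 : ℕ) • Q = 0 → Q = 0)
    (htors' : ∀ Q : (W'.baseChange ℚ_[3]).toAffine.Point, (3 : ℕ) • Q = 0 → Q = 0)
    (hv : ∀ v : HeightOneSpectrum (𝓞 K), ((3 : ℕ) : 𝓞 K) ∉ v.asIdeal →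
      v.asIdeal.ramificationIdx (𝓞 ℚ) = 1 → v.asIdeal.inertiaDeg (𝓞 ℚ) = 1 →
      (W.baseChange K).HasGoodReductionAt v ∨
        ∀ R : ((W.baseChange K).baseChange (v.adicCompletion K)).toAffine.Point,
          (3 : ℕ) • R = 0 → R = 0)
    [Finite (selmerAcBase (W.baseChange K) 3 𝔭 ∅)] :
    Nat.card (IwasawaDual.endInvariants
        (Castella2018.AcSelmer.conjSelmerAc (W.baseChange K) 3 κ 𝔭 ∅ γ - 1)) ≤
      Nat.card ↥(strictSelmerPInfty W 3) * Nat.card ↥(strictSelmerPInfty W' 3) := by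
  have h := (natCard_invariants_le_strictSelmer_mul_tamagawa_of_isFrameThree hF κ hκ γ htors htors' ∅
    (fun v hv0 => absurd hv0 (Finset.notMem_empty v)) (fun v _ => hv v)).2
  simpa using h

end Control

end Summit.BirchSwinnertonDyer.Rank1Residual.X12.O11

end
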